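import Mathlib
import HarnessLib
import Summits.ValiantsHypothesis.ValiantsHypothesis.Theses.MonotoneRestoration
import Summits.ValiantsHypothesis.ValiantsHypothesis.Theorems.MonotoneRestorationMonotoneRestorationQPLinearWidthDefs
import Summits.ValiantsHypothesis.ValiantsHypothesis.Theorems.MonotoneRestorationMonotoneRestorationQPEpsilonComplex
import Summits.ValiantsHypothesis.ValiantsHypothesis.Theorems.MonotoneRestorationMonotoneRestorationQPSparseRegime
import Literature.Computability.AlgebraicComplexity.SymmetricOrbitCircuitEval

/-!
# Line `linear_width` (stmt-ValiantsHypothesis-15886): ladder composition, on-path certificate and the floor, Theorems-side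

Over the Theorems-side vocabulary `…LinearWidthDefs.lean` (p824599).  The parameterless
abbreviations of the skeleton are UNFOLDED through `WidthRung` / explicit ∀-statements (they are not declared Theorems-side).

Over the Theorems-side vocabulary `…LinearWidthDefs.lean` (verbatim the skeleton's): the skeleton's proved glue that
mentions route declarations — `orbitRestorationQP_of_width` / `orbitRestorationQP_of_ladder` (rung + GAP 1 + GAP 2 ⇒ crux
`OrbitRestorationQP`), `MonotoneRestorationQP_of` (the four stub STATEMENTS ⇒ `MonotoneRestorationQP`, THEOREM ε),
`orbitRestorationQP_implies_widthRestorationQP` (ON-PATH: L1 ⇒ every rung) — and THE FLOOR `widthRung_polylogDegree`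
(`WidthRung` at polylogarithmic degree, by the orbit circuit).  No stub is closed; VP ≠ VNP is not touched. [folklore]
-/

set_option linter.dupNamespace false

noncomputable section

namespace Summit.ValiantsHypothesis.ValiantsHypothesis.Theorems.MonotoneRestorationQPLinearWidth

open Summit.ValiantsHypothesis.ValiantsHypothesis.Theses.MonotoneRestoration
open Literature.Computability.AlgebraicComplexity MvPolynomial

/-! ### Proved: compositions -/

/-- Rung-free form for crux `OrbitRestorationQP` (stmt-ValiantsHypothesis-18293):
`WidthRestorationQP → HomDeterminedVP → OrbitRestorationQP`. [folklore] -/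
theorem orbitRestorationQP_of_width
    (hW : ∀ f : (n : ℕ) → MvPolynomial (Fin n × Fin n) ℂ,
      IsMatrixSymmetric f → IsVPFamily f → PolylogHomDetermined f → QPOrbitSymm f)
    (hH : ∀ f : (n : ℕ) → MvPolynomial (Fin n × Fin n) ℂ,
      IsMatrixSymmetric f → IsVPFamily f → PolylogHomDetermined f) :
    OrbitRestorationQP :=
  fun f hs hVP => hW f hs hVP (hH f hs hVP)

/-- **The ladder concludes `OrbitRestorationQP`** from rung + gap 1 + gap 2. [folklore] -/
theorem orbitRestorationQP_of_ladder (h₁ : ∀ c : ℕ, WidthRung fun n => c * (n + 1))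
    (h₂ : (∀ c : ℕ, WidthRung fun n => c * (n + 1)) →
      ∀ f : (n : ℕ) → MvPolynomial (Fin n × Fin n) ℂ,
        IsMatrixSymmetric f → IsVPFamily f → PolylogHomDetermined f → QPOrbitSymm f)
    (h₃ : ∀ f : (n : ℕ) → MvPolynomial (Fin n × Fin n) ℂ,
      IsMatrixSymmetric f → IsVPFamily f → PolylogHomDetermined f) :
    OrbitRestorationQP :=
  orbitRestorationQP_of_width (h₂ h₁) h₃

/-- **THE LINE CONCLUDES THE CRUX** `MonotoneRestorationQP` from the four stub STATEMENTS
(rung, degree lifting, no-arithmetic-CFI, L2): THEOREM ε (`monotoneRestorationQP_iff_complexRestorationQP`)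
+ the ladder composition. [folklore] -/
theorem MonotoneRestorationQP_of :
    (∀ c : ℕ, WidthRung fun n => c * (n + 1)) →
    ((∀ c : ℕ, WidthRung fun n => c * (n + 1)) →
      ∀ f : (n : ℕ) → MvPolynomial (Fin n × Fin n) ℂ,
        IsMatrixSymmetric f → IsVPFamily f → PolylogHomDetermined f → QPOrbitSymm f) →
    (∀ f : (n : ℕ) → MvPolynomial (Fin n × Fin n) ℂ,
      IsMatrixSymmetric f → IsVPFamily f → PolylogHomDetermined f) →
    (∀ f : (n : ℕ) → MvPolynomial (Fin n × Fin n) ℂ,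
      (∀ (n : ℕ) (σ τ : Equiv.Perm (Fin n)),
        MvPolynomial.rename (fun p : Fin n × Fin n => (σ p.1, τ p.2)) (f n) = f n) →
      IsVPFamily f →
      (∃ c : ℕ, ∀ n : ℕ, ∃ (G : Type) (_ : Fintype G)
        (C : LabelledArithCircuit ℂ (Fin n × Fin n) Unit G),
        C.IsSymmetric (Equiv.Perm (Fin n)) ∧ C.eval (C.output ()) = f n ∧
          C.orbitSize (Equiv.Perm (Fin n)) ≤ 2 ^ ((Nat.log 2 n + c) ^ c)) →
      ∃ c : ℕ, ∀ n : ℕ, ∃ (G : Type) (_ : Fintype G)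
        (C : LabelledArithCircuit ℂ (Fin n × Fin n) Unit G),
        C.IsSymmetric (Equiv.Perm (Fin n)) ∧ C.eval (C.output ()) = f n ∧
          Fintype.card G ≤ 2 ^ ((Nat.log 2 n + c) ^ c)) →
    MonotoneRestorationQP := by
  intro h₁ h₂ h₃ h₄
  exact monotoneRestorationQP_iff_complexRestorationQP.mpr fun f hs hVP =>
    h₄ f hs hVP (orbitRestorationQP_of_ladder h₁ h₂ h₃ f hs hVP)

/-! ### Proved: the family is graded, the floor holds, the top implies every rung -/

/-- ON-PATH: the top `OrbitRestorationQP` implies `WidthRestorationQP` and every `WidthRung d`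
(the rungs are restrictions of L1). [folklore] -/
theorem orbitRestorationQP_implies_widthRestorationQP (h : OrbitRestorationQP) :
    (∀ f : (n : ℕ) → MvPolynomial (Fin n × Fin n) ℂ,
      IsMatrixSymmetric f → IsVPFamily f → PolylogHomDetermined f → QPOrbitSymm f) ∧ ∀ d, WidthRung d :=
  ⟨fun f hs hVP _ => h f hs hVP, fun _ f hs hVP _ _ => h f hs hVP⟩

/-- **THE FLOOR (F3 witness): `WidthRung` at polylogarithmic degree is a theorem** — by the orbit
circuit (`OrbitCircuit.exists_symmetric_circuit_of_invariant`: size, hence orbit size,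
`≤ n² + |supp|·n²·deg + 2|supp| + 1`, and `|supp| ≤ (n²+1)^deg`); neither `IsVPFamily` nor the width
hypothesis is used.  Orbit form of the landed `monotoneRestorationQP_of_polylogDegree`. [folklore] -/
theorem widthRung_polylogDegree (c : ℕ) : WidthRung fun n => (Nat.log 2 n + c) ^ c := by
  intro f hs _hVP hdeg _hdet
  obtain ⟨c₁, hc₁⟩ := SparseRegime.polylogDegree_sparse_le c
  obtain ⟨c', hc'⟩ := SparseRegime.qpSparse_size_le c₁
  refine ⟨c', fun n => ?_⟩
  have hinv : ∀ σ : Equiv.Perm (Fin n),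
      rename (fun pq : Fin n × Fin n => σ • pq) (f n) = f n := fun σ => hs n σ σ
  obtain ⟨G, inst, C, hCs, hCe, hCc⟩ := OrbitCircuit.exists_symmetric_circuit_of_invariant (f n) hinv
  refine ⟨G, inst, C, hCs, hCe, (C.orbitSize_le_size (Equiv.Perm (Fin n))).trans
    (hCc.trans (hc' n _ _ ?_ (hc₁ n _ (hdeg n)).2))⟩
  calc (f n).support.card ≤ (Fintype.card (Fin n × Fin n) + 1) ^ (f n).totalDegree :=
        OrbitCircuit.card_support_le_of_totalDegree_le (f n) le_rfl
    _ = (n * n + 1) ^ (f n).totalDegree := by rw [Fintype.card_prod, Fintype.card_fin]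
    _ ≤ 2 ^ ((Nat.log 2 n + c₁) ^ c₁) := (hc₁ n _ (hdeg n)).1



end Summit.ValiantsHypothesis.ValiantsHypothesis.Theorems.MonotoneRestorationQPLinearWidth

end
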